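import Literature.NumberTheory.EllipticCurves.MordellCurveTateAlgorithmTwoProofs
import HarnessLib

/-!
# BSD rank-≤1 residual cell, class X11 ∧ r = 1 ∧ ¬sst ∧ p ≥ 5: Kraus's conditions at `2` and `3`
# as MINIMALITY CRITERIA over `ℚ₂` / `ℚ₃` (the local lemmas behind the last instance binder of the
# 85 certificate records)

HONEST FRAMING (cell `b2b-bsdres-*`, verbatim): prove what is provable now; shrink each hard class
to its core with data; no claim beyond stated classes. The cell deletes COMBINATION-shaped residual
classes from PUBLISHED theorems only; the CONSTRUCTION-shaped remainder is typed, not attempted; this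
is not "finishing BSD". Nothing here is specific to BSD: three elementary minimality criteria for a
locally integral Weierstrass equation, used by the companion file
`Rank1ResidualX11RankOneMinimality.lean` to discharge `[IsGloballyMinimal]` for the six census models
`6240be1`, `10080bo1`, `10080ca1`, `16560cf1`, `17360bo1` (`ord₂ Δ = 12`, `ord₂ c₄ ≥ 4`) and
`15390b1` (`ord₃ Δ = 12`, `ord₃ c₄ = 5`, `ord₃ c₆ = 8`), where Silverman's sufficient criterion
(`ord Δ < 12` or `ord c₄ < 4`, AEC VII.1 Remark 1.1) is silent. Theorems only (no definition, no
named fact).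

* §1 (place of `3`). `kraus_three_of_integral`: a `ℤ₃`-integral Weierstrass equation has
  `|c₆|₃ = 1` or `|c₆|₃ ≤ 3⁻³` (`c₆ = −b₂³ + 36 b₂ b₄ − 216 b₆`: if `3 ∣ b₂` every term is in `27ℤ₃`,
  else `c₆ ≡ −b₂³` is a unit) — the necessity half of Kraus's condition at `3` (Kraus 1989 Prop. 1:
  an integral equation with invariants `c₄, c₆` exists at `3` iff `ord₃ c₆ ≠ 2`, given
  `c₄³ − c₆² = 1728Δ`); hence `isMinimal_three_of_valued_c₆`: an integral equation with
  `ord₃ c₆ = 8` is minimal at `3` (a rescaling by `u`, `ord₃ u⁻¹ = m ≥ 1`, has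
  `ord₃ c₆' = 8 − 6m ∈ {2} ∪ ℤ_{<0}`).
* §2 (place of `2`). From the tree's Kraus-at-`2` theorems (`kraus_two_of_integral`: an integral
  equation has `16 ∣ c₄ ∧ c₆ ≡ 0, 8 (mod 32)` or `c₆ ≡ −1 (mod 4)`; `isMinimal_of_kraus_fails`,
  `isMinimal_of_kraus_fails_of_Δ`): `isMinimal_two_of_valued_c₄_c₆` (`4 ≤ ord₂ c₄ < 8` and
  `ord₂ c₆ ≥ 7` ⟹ minimal) and `isMinimalAt_two_of_c₆_eq_512_mul` (`ord₂ Δ < 24`, `c₆ = 2⁹L`,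
  `L ≡ 3 (mod 4)` ⟹ minimal).

References: A. Kraus, *Quelques remarques à propos des invariants c₄, c₆ et Δ d'une courbe
elliptique*, Acta Arith. 54 (1989) 75–80, Prop. 1 (`p = 3`), Prop. 2 (`p = 2`) [Kraus1989];
J. E. Cremona, *Algorithms for Modular Elliptic Curves* (1997) §3.2 (Laska–Kraus–Connell: "IF
ord₃(c₆) = 6d + 2 THEN d := d − 1"; the `p = 2` tests) [CremonaAlgorithms1997]; J. H. Silverman,
*AEC* (2009) III.1 (Table 3.1: `c₄ ↦ u⁻⁴c₄`, `c₆ ↦ u⁻⁶c₆`, `Δ ↦ u⁻¹²Δ`), VII.1 [SilvermanAEC2009].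
-/

set_option linter.dupNamespace false
set_option autoImplicit false

noncomputable section

open scoped Classical

open IsDedekindDomain NumberField Rat.HeightOneSpectrum WeierstrassCurve
  Literature.NumberTheory.EllipticCurves Literature.NumberTheory.GaloisRepresentations


namespace Summit.BirchSwinnertonDyer.BirchSwinnertonDyer.Rank1Residual.X11RankOne

/-! ### §1. The place of `3`: Kraus's necessary condition and minimality from `ord₃ c₆ = 8` -/

section Three

variable (v : HeightOneSpectrum (𝓞 ℚ))

/-- At the place over `3`: `|3|_v = exp(-1)`. [folklore] -/
theorem valued_three (hv : natGenerator v = 3) :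
    Valued.v (3 : v.adicCompletion ℚ) = WithZero.exp (-1 : ℤ) := by
  have h := Rat.valuation_natGenerator v
  rw [hv, Nat.cast_ofNat] at h
  rw [← map_ofNat (algebraMap ℚ (v.adicCompletion ℚ)) 3, WeierstrassCurve.valued_algebraMap_adicCompletion, h]

/-- At the place over `3`: `|n|_v ≤ exp(-e)` for a natural number `n` with `3^e ∣ n`. [folklore] -/
theorem valued_natCast_le_of_three_pow_dvd (hv : natGenerator v = 3) {n e : ℕ} (h : 3 ^ e ∣ n) :
    Valued.v (n : v.adicCompletion ℚ) ≤ WithZero.exp (-(e : ℤ)) := by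
  have h' : (natGenerator v : ℤ) ^ e ∣ (n : ℤ) := by rw [hv]; exact_mod_cast h
  have := Rat.valuation_intCast_le v h'
  rw [← map_natCast (algebraMap ℚ (v.adicCompletion ℚ)) n, WeierstrassCurve.valued_algebraMap_adicCompletion]
  exact_mod_cast this

/-- **Kraus's necessary condition at `3`** (Kraus 1989, Prop. 1, necessity: `ord₃ c₆ ≠ 2`; here in
the sharper form the proof gives). For a `3`-adically integral Weierstrass equation `M`:
`|c₆|₃ = 1` or `|c₆|₃ ≤ 3⁻³`. Indeed `c₆ = −b₂³ + 36 b₂ b₄ − 216 b₆` with `b₂, b₄, b₆ ∈ ℤ₃`; if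
`|b₂| ≤ 3⁻¹` each term has absolute value `≤ 3⁻³`; if `|b₂| = 1` then `|36 b₂ b₄ − 216 b₆| ≤ 3⁻²`
and `|c₆| = |b₂³| = 1`. [cite: Kraus1989, Prop. 1] [cite: SilvermanAEC2009, III.1 (b₂, b₄, b₆, c₆)] -/
theorem kraus_three_of_integral (hv : natGenerator v = 3) (M : WeierstrassCurve (v.adicCompletion ℚ))
    [M.IsIntegral (v.adicCompletionIntegers ℚ)] :
    Valued.v M.c₆ = 1 ∨ Valued.v M.c₆ ≤ WithZero.exp (-3 : ℤ) := by
  set O := v.adicCompletionIntegers ℚ with hO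
  have hb2 : Valued.v M.b₂ ≤ 1 := by
    rw [← integralModel_b₂_eq O M]
    exact (valued_le_one_iff_mem_range_adicCompletionIntegers v _).mpr ⟨_, rfl⟩
  have hb4 : Valued.v M.b₄ ≤ 1 := by
    rw [← integralModel_b₄_eq O M]
    exact (valued_le_one_iff_mem_range_adicCompletionIntegers v _).mpr ⟨_, rfl⟩
  have hb6 : Valued.v M.b₆ ≤ 1 := by
    rw [← integralModel_b₆_eq O M]
    exact (valued_le_one_iff_mem_range_adicCompletionIntegers v _).mpr ⟨_, rfl⟩
  have h36 : Valued.v (36 : v.adicCompletion ℚ) ≤ WithZero.exp (-2 : ℤ) := by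
    simpa using valued_natCast_le_of_three_pow_dvd v hv (n := 36) (e := 2) (by norm_num)
  have h216 : Valued.v (216 : v.adicCompletion ℚ) ≤ WithZero.exp (-3 : ℤ) := by
    simpa using valued_natCast_le_of_three_pow_dvd v hv (n := 216) (e := 3) (by norm_num)
  have hc6 : M.c₆ = -M.b₂ ^ 3 + (36 * M.b₂ * M.b₄ - 216 * M.b₆) := by
    simp only [WeierstrassCurve.c₆]; ring
  have t3 : Valued.v (216 * M.b₆) ≤ WithZero.exp (-3 : ℤ) := by
    rw [Valuation.map_mul]
    calc Valued.v (216 : v.adicCompletion ℚ) * Valued.v M.b₆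
        ≤ WithZero.exp (-3 : ℤ) * 1 := mul_le_mul' h216 hb6
      _ = WithZero.exp (-3 : ℤ) := mul_one _
  by_cases hβ : Valued.v M.b₂ < 1
  · -- `3 ∣ b₂`: every term is in `27 ℤ₃`
    right
    have hβ' : Valued.v M.b₂ ≤ WithZero.exp (-1 : ℤ) := valued_le_exp_neg_one_of_lt_one v hβ
    have t1 : Valued.v (-M.b₂ ^ 3) ≤ WithZero.exp (-3 : ℤ) := by
      rw [Valuation.map_neg, Valuation.map_pow, show (-3 : ℤ) = 3 • (-1 : ℤ) by norm_num,
        WithZero.exp_nsmul]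
      exact pow_le_pow_left' hβ' 3
    have t2 : Valued.v (36 * M.b₂ * M.b₄) ≤ WithZero.exp (-3 : ℤ) := by
      rw [Valuation.map_mul, Valuation.map_mul]
      calc Valued.v (36 : v.adicCompletion ℚ) * Valued.v M.b₂ * Valued.v M.b₄
          ≤ WithZero.exp (-2 : ℤ) * WithZero.exp (-1 : ℤ) * 1 :=
            mul_le_mul' (mul_le_mul' h36 hβ') hb4
        _ = WithZero.exp (-3 : ℤ) := by rw [mul_one, ← WithZero.exp_add]; norm_num
    rw [hc6]
    exact Valuation.map_add_le _ t1 (Valuation.map_sub_le _ t2 t3)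
  · -- `b₂` a unit: `c₆ ≡ -b₂³` is a unit
    left
    have hβ1 : Valued.v M.b₂ = 1 := le_antisymm hb2 (not_lt.mp hβ)
    have t2 : Valued.v (36 * M.b₂ * M.b₄) ≤ WithZero.exp (-2 : ℤ) := by
      rw [Valuation.map_mul, Valuation.map_mul, hβ1, mul_one]
      calc Valued.v (36 : v.adicCompletion ℚ) * Valued.v M.b₄
          ≤ WithZero.exp (-2 : ℤ) * 1 := mul_le_mul' h36 hb4
        _ = WithZero.exp (-2 : ℤ) := mul_one _
    have hsmall : Valued.v (36 * M.b₂ * M.b₄ - 216 * M.b₆) ≤ WithZero.exp (-2 : ℤ) :=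
      Valuation.map_sub_le _ t2 (t3.trans (by rw [WithZero.exp_le_exp]; norm_num))
    have hbig : Valued.v (-M.b₂ ^ 3) = 1 := by
      rw [Valuation.map_neg, Valuation.map_pow, hβ1, one_pow]
    have hlt : Valued.v (36 * M.b₂ * M.b₄ - 216 * M.b₆) < Valued.v (-M.b₂ ^ 3) := by
      rw [hbig]
      exact lt_of_le_of_lt hsmall (by rw [← WithZero.exp_zero, WithZero.exp_lt_exp]; norm_num)
    rw [hc6, Valuation.map_add_eq_of_lt_left _ hlt, hbig]

/-- **Minimality at `3` from `ord₃ c₆ = 8`.** A `3`-adically integral Weierstrass equation `Y` over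
`ℚ₃` with `3⁻⁹ < |c₆(Y)|₃ ≤ 3⁻⁸` is minimal: an integral `C • Y` with `|u⁻¹| = 3^m`, `m ≥ 1`, would
have `|c₆(C • Y)| = 3^{6m} |c₆(Y)| = 3^{6m−8}`, which is neither `1` nor `≤ 3⁻³`, contradicting
`kraus_three_of_integral`. (Silverman *AEC* VII.1: minimality, and III.1 Table 3.1: `c₆ ↦ u⁻⁶ c₆`,
`Δ ↦ u⁻¹² Δ`.) Covers the census model `15390b1`. [cite: Kraus1989, Prop. 1]
[cite: SilvermanAEC2009, VII.1 (Definition) and III.1 Table 3.1] -/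
theorem isMinimal_three_of_valued_c₆ (hv : natGenerator v = 3)
    (Y : WeierstrassCurve (v.adicCompletion ℚ)) [Y.IsIntegral (v.adicCompletionIntegers ℚ)]
    (h8 : Valued.v Y.c₆ ≤ WithZero.exp (-8 : ℤ)) (h9 : WithZero.exp (-9 : ℤ) < Valued.v Y.c₆) :
    Y.IsMinimal (v.adicCompletionIntegers ℚ) := by
  rw [isMinimal_iff_of_le_one_iff (valued_le_one_iff_mem_range_adicCompletionIntegers v)]
  refine ⟨inferInstance, fun C hC ↦ ?_⟩
  haveI := hC
  rw [variableChange_Δ, Valuation.map_mul, Valuation.map_pow]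
  set U : WithZero (Multiplicative ℤ) := Valued.v (↑C.u⁻¹ : v.adicCompletion ℚ) with hU
  by_cases hU1 : U ≤ 1
  · exact mul_le_of_le_one_left zero_le (pow_le_one₀ zero_le hU1)
  exfalso
  replace hU1 : 1 < U := not_le.mp hU1
  have hU0 : U ≠ 0 := (Valuation.ne_zero_iff _).mpr (Units.ne_zero _)
  set c := Valued.v Y.c₆ with hc
  have hc0 : c ≠ 0 := (WithZero.exp_pos.trans h9).ne'
  have hl1 : 0 < WithZero.log U := WithZero.lt_log_of_exp_lt (by rwa [WithZero.exp_zero])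
  have hk8 : WithZero.log c ≤ -8 := (WithZero.log_le_iff_le_exp hc0).mpr h8
  have hk9 : -9 < WithZero.log c := (WithZero.lt_log_iff_exp_lt hc0).mpr h9
  have hK := kraus_three_of_integral v hv (C • Y)
  rw [variableChange_c₆, Valuation.map_mul, Valuation.map_pow] at hK
  have hne : U ^ 6 * c ≠ 0 := mul_ne_zero (pow_ne_zero _ hU0) hc0
  rcases hK with h | h
  · have h1 : WithZero.log (U ^ 6 * c) = 0 := by rw [h, WithZero.log_one]
    rw [WithZero.log_mul (pow_ne_zero _ hU0) hc0, WithZero.log_pow] at h1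
    simp only [nsmul_eq_mul, Nat.cast_ofNat] at h1
    omega
  · have h1 : WithZero.log (U ^ 6 * c) ≤ -3 := (WithZero.log_le_iff_le_exp hne).mpr h
    rw [WithZero.log_mul (pow_ne_zero _ hU0) hc0, WithZero.log_pow] at h1
    simp only [nsmul_eq_mul, Nat.cast_ofNat] at h1
    omega

end Three

/-! ### §2. The place of `2`: two Kraus patterns, from the tree's Kraus-at-`2` theorems -/

section Two

variable (v : HeightOneSpectrum (𝓞 ℚ))

/-- **Minimality at `2`, pattern `4 ≤ ord₂ c₄ < 8`, `ord₂ c₆ ≥ 7`.** A `2`-adically integral equation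
`Y` over `ℚ₂` with `2⁻⁸ < |c₄(Y)|₂` and `|c₆(Y)|₂ ≤ 2⁻⁷` is minimal: for the only possible descent
`u = 2w` (`w` a unit) the descended invariants `c₄' = c₄/(16w⁴)`, `c₆' = c₆/(64w⁶)` have
`|c₄'| > 2⁻⁴` (so Kraus's first alternative `16 ∣ c₄'` fails) and `|c₆'| ≤ 2⁻¹ < 1`, so `c₆' + 1`
is a unit (the alternative `c₆' ≡ −1 (mod 4)` fails) — `isMinimal_of_kraus_fails`. Covers the
census models `6240be1`, `10080bo1`, `10080ca1` (`ord₂ c₄ = 7`, `ord₂ c₆ = 9`).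
[cite: Kraus1989, Prop. 2] [cite: CremonaAlgorithms1997, §3.2 (Laska–Kraus–Connell)] -/
theorem isMinimal_two_of_valued_c₄_c₆ (hv : natGenerator v = 2)
    (Y : WeierstrassCurve (v.adicCompletion ℚ)) [Y.IsIntegral (v.adicCompletionIntegers ℚ)]
    (h4 : WithZero.exp (-8 : ℤ) < Valued.v Y.c₄) (h6 : Valued.v Y.c₆ ≤ WithZero.exp (-7 : ℤ)) :
    Y.IsMinimal (v.adicCompletionIntegers ℚ) := by
  have V2 := valued_two v hv
  have h20 : (2 : v.adicCompletion ℚ) ≠ 0 := by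
    intro h; rw [h, Valuation.map_zero] at V2; exact WithZero.coe_ne_zero V2.symm
  have V16 : Valued.v (16 : v.adicCompletion ℚ) = WithZero.exp (-4 : ℤ) := by
    rw [show (16 : v.adicCompletion ℚ) = 2 ^ 4 by norm_num, Valuation.map_pow, V2,
      ← WithZero.exp_nsmul]; norm_num
  have V64 : Valued.v (64 : v.adicCompletion ℚ) = WithZero.exp (-6 : ℤ) := by
    rw [show (64 : v.adicCompletion ℚ) = 2 ^ 6 by norm_num, Valuation.map_pow, V2,
      ← WithZero.exp_nsmul]; norm_num
  refine isMinimal_of_kraus_fails v hv Y h4 fun w hw H ↦ ?_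
  have hw4 : Valued.v (16 * w ^ 4) = WithZero.exp (-4 : ℤ) := by
    rw [Valuation.map_mul, Valuation.map_pow, hw, one_pow, mul_one, V16]
  have hw6 : Valued.v (64 * w ^ 6) = WithZero.exp (-6 : ℤ) := by
    rw [Valuation.map_mul, Valuation.map_pow, hw, one_pow, mul_one, V64]
  rcases H with ⟨h1, -⟩ | h3
  · -- `|c₄ / (16 w⁴)| = |c₄|·2⁴ > 2⁻⁴`
    rw [map_div₀, hw4, div_le_iff₀ WithZero.exp_pos, withZero_exp_mul_exp] at h1
    norm_num at h1
    exact absurd (lt_of_lt_of_le h4 h1) (lt_irrefl _)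
  · -- `|c₆ / (64 w⁶)| ≤ 2⁻¹ < 1`, so `c₆' + 1` is a unit
    have hlt : Valued.v (Y.c₆ / (64 * w ^ 6)) < Valued.v (1 : v.adicCompletion ℚ) := by
      rw [map_div₀, hw6, Valuation.map_one, div_lt_iff₀ WithZero.exp_pos, one_mul]
      exact lt_of_le_of_lt h6 (by rw [WithZero.exp_lt_exp]; norm_num)
    rw [Valuation.map_add_eq_of_lt_right _ hlt, Valuation.map_one, ← WithZero.exp_zero,
      WithZero.exp_le_exp] at h3
    norm_num at h3

variable (W : WeierstrassCurve ℚ)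

/-- **Minimality at `2`, pattern `c₆ = 2⁹L`, `L ≡ 3 (mod 4)`, `ord₂ Δ < 24`.** For `W / ℚ` integral at
the place `v` of `2` with `|Δ|₂ > 2⁻²⁴` and `c₆(W) = 512·L`, `4 ∣ L − 3`: `W` is minimal at `v`. For
the only possible descent `u = 2w` the descended `c₆' = c₆/(64w⁶) = 8y` with `y = L w⁻⁶` a unit,
`y ≡ 3 (mod 4)` (`w⁻⁶ ≡ 1 (mod 8)`): `|c₆'| = 2⁻³ > 2⁻⁵`, `|c₆' − 8| = |8(y − 1)| = 2⁻⁴ > 2⁻⁵`, and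
`c₆' + 1` is a unit, so all of Kraus's alternatives fail (`isMinimal_of_kraus_fails_of_Δ`; the same
computation as the tree's `not_hasGoodReductionAt_two_of_c₆_eq_512_mul`). Covers the census models
`6240be1`, `16560cf1`, `17360bo1`. [cite: Kraus1989, Prop. 2]
[cite: CremonaAlgorithms1997, §3.2 (Laska–Kraus–Connell)] -/
theorem isMinimalAt_two_of_c₆_eq_512_mul (hv : natGenerator v = 2) (hint : W.IsIntegralAt v)
    (hΔ : WithZero.exp (-24 : ℤ) < v.valuation ℚ W.Δ) {L : ℤ} (hL : W.c₆ = 512 * L)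
    (hL3 : (4 : ℤ) ∣ L - 3) : W.IsMinimalAt v := by
  set K := v.adicCompletion ℚ with hK
  set Y : WeierstrassCurve K := W.baseChange K with hY
  haveI : Y.IsIntegral (v.adicCompletionIntegers ℚ) := hint
  have V2 := valued_two v hv
  have h20 : (2 : K) ≠ 0 := by
    intro h; rw [h, Valuation.map_zero] at V2; exact WithZero.coe_ne_zero V2.symm
  have V8 : Valued.v (8 : K) = WithZero.exp (-3 : ℤ) := by
    rw [show (8 : K) = 2 ^ 3 by norm_num, Valuation.map_pow, V2, ← WithZero.exp_nsmul]; norm_num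
  have hYΔ : WithZero.exp (-24 : ℤ) < Valued.v Y.Δ := by
    rw [hY, WeierstrassCurve.baseChange, map_Δ, WeierstrassCurve.valued_algebraMap_adicCompletion]; exact hΔ
  have hYc6 : Y.c₆ = 512 * algebraMap ℚ K L := by
    rw [hY, WeierstrassCurve.baseChange, map_c₆, hL, map_mul]; norm_num
  -- the integer `L`: odd, `≡ 3 (mod 4)`
  have hLodd : ¬ (2 : ℤ) ∣ L := fun h ↦ by
    have h4 : (2 : ℤ) ∣ L - 3 := dvd_trans ⟨2, by norm_num⟩ hL3
    have : (2 : ℤ) ∣ 3 := by simpa using dvd_sub h h4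
    norm_num at this
  set l : K := algebraMap ℚ K L with hl
  have hVl : Valued.v l = 1 := valued_intCast_eq_one_of_odd v hv hLodd
  have hVl3 : Valued.v (l - 3) ≤ WithZero.exp (-2 : ℤ) := by
    have := valued_intCast_le_of_dvd v hv (n := L - 3) (e := 2) (by simpa using hL3)
    rwa [Int.cast_sub, map_sub, show ((3 : ℤ) : ℚ) = 3 by norm_num, map_ofNat] at this
  refine isMinimal_of_kraus_fails_of_Δ v hv Y hYΔ fun w hw H ↦ ?_
  have hw0 : w ≠ 0 := by
    intro h; rw [h, Valuation.map_zero] at hw; exact zero_ne_one hw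
  have hwi : Valued.v w⁻¹ = 1 := by rw [map_inv₀, hw, inv_one]
  set y : K := w⁻¹ ^ 6 * l with hy
  have hunit : Valued.v y = 1 := by
    rw [hy, Valuation.map_mul, Valuation.map_pow, hwi, one_pow, one_mul, hVl]
  have h64 : (64 : K) ≠ 0 := by
    rw [show (64 : K) = 2 ^ 6 by norm_num]; exact pow_ne_zero _ h20
  have he : Y.c₆ / (64 * w ^ 6) = 8 * y := by
    rw [hYc6, hy, div_eq_iff (mul_ne_zero h64 (pow_ne_zero 6 hw0)), inv_pow,
      show (8 : K) * ((w ^ 6)⁻¹ * l) * (64 * w ^ 6) = 512 * l * ((w ^ 6)⁻¹ * w ^ 6) by ring,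
      inv_mul_cancel₀ (pow_ne_zero 6 hw0), mul_one]
  rw [he] at H
  rcases H with ⟨-, h | h⟩ | h
  · rw [Valuation.map_mul, V8, hunit, mul_one, WithZero.exp_le_exp] at h
    norm_num at h
  · -- `8y - 8 = 8(y - 1)`, `y - 1 = (w⁻⁶ - 1)L + (L - 3) + 2` has valuation `exp(-1)`
    have h6 := valued_pow_six_sub_one_le v hv hwi
    have hsmall : Valued.v ((w⁻¹ ^ 6 - 1) * l + (l - 3)) ≤ WithZero.exp (-2 : ℤ) := by
      refine Valuation.map_add_le _ ?_ hVl3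
      rw [Valuation.map_mul, hVl, mul_one]
      exact h6.trans (by rw [WithZero.exp_le_exp]; norm_num)
    have hlt2 : Valued.v ((w⁻¹ ^ 6 - 1) * l + (l - 3)) < Valued.v (2 : K) := by
      rw [V2]; exact lt_of_le_of_lt hsmall (by rw [WithZero.exp_lt_exp]; norm_num)
    have hy1 : Valued.v (y - 1) = WithZero.exp (-1 : ℤ) := by
      have : y - 1 = ((w⁻¹ ^ 6 - 1) * l + (l - 3)) + 2 := by rw [hy]; ring
      rw [this, Valuation.map_add_eq_of_lt_right _ hlt2, V2]
    have : (8 : K) * y - 8 = 8 * (y - 1) := by ring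
    rw [this, Valuation.map_mul, V8, hy1, withZero_exp_mul_exp, WithZero.exp_le_exp] at h
    norm_num at h
  · have hlt3 : Valued.v (8 * y) < Valued.v (1 : K) := by
      rw [Valuation.map_one, Valuation.map_mul, V8, hunit, mul_one, ← WithZero.exp_zero,
        WithZero.exp_lt_exp]
      norm_num
    have : Valued.v (8 * y + 1) = 1 := by
      rw [Valuation.map_add_eq_of_lt_right _ hlt3, Valuation.map_one]
    rw [this, ← WithZero.exp_zero, WithZero.exp_le_exp] at h
    norm_num at h

end Two

end Summit.BirchSwinnertonDyer.BirchSwinnertonDyer.Rank1Residual.X11RankOne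

end
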